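import Summits.BirchSwinnertonDyer.BirchSwinnertonDyer.Theorems.AdditiveBranchIMCGordTwoRankOneShaAnUnit
import HarnessLib

/-!
# Route `AdditiveBranchIMC` (rung K1), crux `GordTwoRankOne` (item 19358): ONE booking door per image family for the
# X4♯(G-ord, `e = 2`) ∩ surj rank-one rows at EVERY odd `p`, and its isogeny-class form
# (cell `bsd-addord`, seat `bsd-addord-k1-c3` gen 6, D-0074 row B2)

HONEST FRAMING. THEOREMS ONLY: no definition, no named fact, no `sorry`, nothing booked; BSD is not proved by any of
this; crux `GordTwoRankOne` stays OPEN at class level on its content window (Λ-adic children 19497/19498, certificate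
child 19499). This file only re-packages gen 5's three per-parity doors
`classX4Gord_bsdp_rankOne{,_odd,_three}_of_katoHalf_of_branchCoeffOneNeZero_of_shaAnUnit` (file `…ShaAnUnit`, §1) as ONE
declaration valid at every odd prime (the parity / `p = 3` dispatch is done inside), in the two datum currencies used by
the booking desks (`ord_p s ≤ 0`, and the EXACT-`#Ш_an` shape `padicValRat p q = 0` of the D3X4R1 / F3BW doors), plus the
ISOGENY-CLASS form (Cassels transport `N10.bsdp_of_isIsogenous_of_bsdp`): a booking table for the X4♯(G-ord, `e = 2`) ∩
surj ∩ `r_an = 1` keys (seat table `HOME/k1-c3/x4r1-g6/KEYS.tsv`: 115 S-b keys at `p ∈ {5, 7}`, 541 at `p = 3`) then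
names a single consumer theorem per key, whatever `p mod 4` is.

Per key the inputs are unchanged: Kato's half-eigenspace reading `hK`, the cite-only facts `hCyc hArt h73 hWald hmod hmodD
hmodN hGZK` (+ `hCassels` for the class form), the decidable data `ClassX4Gord W p`, `e = 2`, `Surj W p`, `r_an = 1`, the
two-engine certificate `A′ ≠ 0` (`BranchCoeffOneNeZeroAt W p`) and the datum `#Ш(E)_an = s`, `ord_p s ≤ 0`.
References: [Kato2004Asterisque] Thm. 17.4 (3); [Wuthrich2014] Lemma 20; [Delbourgo2002] Thm. (B); [Disegni2017] Thm. A/B;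
[MazurTateTeitelbaum1986Invent] §I.13–I.14; [MilneADT2006] Thm. I.7.3; [Miller2011LMS] Def. 1.1; HOME/k1-c3/CERT-ROADS-19358-g5.md.
-/

set_option autoImplicit false
set_option linter.dupNamespace false
noncomputable section
open scoped Classical MatrixGroups ModularForm NumberField
open CongruenceSubgroup WeierstrassCurve NumberField IsDedekindDomain Field
  Literature.NumberTheory.EllipticCurves Literature.NumberTheory.EllipticCurves.ModularForms
  Literature.NumberTheory.EllipticCurves.GreenbergVatsal2000
  Literature.NumberTheory.EllipticCurves.Rank1Residual
  Literature.NumberTheory.EllipticCurves.Rank1Residual.Typed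
  Literature.NumberTheory.EllipticCurves.Delbourgo2002
  Literature.NumberTheory.EllipticCurves.Disegni2017
  Literature.NumberTheory.GaloisRepresentations
  Summit.BirchSwinnertonDyer.Rank1Residual.AdditivePotMult
  Summit.BirchSwinnertonDyer.Rank1Residual.Additive
  Summit.BirchSwinnertonDyer.BirchSwinnertonDyer.Theses.AdditiveBranchIMC

namespace Summit.BirchSwinnertonDyer.BirchSwinnertonDyer.Theorems.AdditiveBranchIMCGordTwoRankOne

/-- **X4♯(G-ord) ∩ `I₀*` ∩ {`ρ̄_{E,p}` onto}, `r_an(E) = 1`, ANY odd `p` (anomalous or not): `BSD(E,p)` from Kato's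
half-eigenspace reading `hK`, the cite-only facts `hCyc hArt h73 hWald hmod hmodD hmodN hGZK`, the two-engine certificate
`A′ ≠ 0` (`BranchCoeffOneNeZeroAt W p`) and the datum `#Ш(E)_an = s`, `ord_p s ≤ 0`.** One declaration for every odd
prime: `p = 3` ↦ gen 5's `…_three_…` door (there `e = 2` is automatic), `p ≡ 1 (mod 4)` ↦ the even door, `p ≡ 3 (mod 4)`,
`p ≥ 5` ↦ the odd door. `p ≠ 2` is part of `ClassX4Gord`. Nothing booked.
[cite: Kato2004Asterisque, Thm. 17.4 (3) (p. 273)] [cite: Wuthrich2014, Lemma 20 (p. 399)]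
[cite: Delbourgo2002, Theorem (B) (p. 40)] [cite: Disegni2017, Theorem A/B (arXiv v3 PDF 7–9)]
[cite: MazurTateTeitelbaum1986Invent, §I.13–I.14] [cite: Miller2011LMS, Def. 1.1] -/
theorem classX4Gord_bsdp_rankOne_anyOdd_of_katoHalf_of_branchCoeffOneNeZero_of_shaAnUnit
    (hK : Wuthrich2014.kato_halfEigenCharIdeal_dvd_cyclotomicPrime_of_surjective)
    (hCyc : delbourgoDatum_cycLineGrossZagier)
    (hArt : rankinSelbergEulerProductHecke_baseChangeDirichlet_eq) (h73 : GrossZagier1986_thm_I_7_3)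
    (hWald : waldspurger_exists_heegnerField_twist_ne_zero)
    (hmod : hasEntireLFunction_rat) (hmodD : nonempty_modularParametrizationData)
    (hmodN : exists_isNewformOf) (hGZK : rank_eq_analyticRank_of_analyticRank_le_one)
    {W : WeierstrassCurve ℚ} [W.IsElliptic] [W.IsGloballyMinimal] {p : ℕ} [Fact p.Prime]
    (hX : ClassX4Gord W p) (he : semistabilityIndex W p = 2) (hsurj : Surj W p)
    (hr : W.analyticRank = 1) (hne : BranchCoeffOneNeZeroAt W p)
    {s : ℚ} (hs : shaAn W = (s : ℂ)) (hsv : padicValRat p s ≤ 0) : BSDp W p := by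
  by_cases hp3 : p = 3
  · subst hp3
    exact classX4Gord_bsdp_rankOne_three_of_katoHalf_of_branchCoeffOneNeZero_of_shaAnUnit hK hCyc hArt h73
      hWald hmod hmodD hmodN hGZK hX hsurj hr hne hs hsv
  · have hp5 : 5 ≤ p := (Fact.out : p.Prime).five_le_of_ne_two_of_ne_three hX.addv.1 hp3
    have hodd : p % 4 = 1 ∨ p % 4 = 3 := by
      obtain ⟨k, hk⟩ := (Fact.out : p.Prime).odd_of_ne_two hX.addv.1
      omega
    rcases hodd with h1 | h3
    · exact classX4Gord_bsdp_rankOne_of_katoHalf_of_branchCoeffOneNeZero_of_shaAnUnit hK hCyc hArt h73 hWald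
        hmod hmodD hmodN hGZK hX he h1 hsurj hr hne hs hsv
    · exact classX4Gord_bsdp_rankOne_odd_of_katoHalf_of_branchCoeffOneNeZero_of_shaAnUnit hK hCyc hArt h73
        hWald hmod hmodD hmodN hGZK hX he h3 hp5 hsurj hr hne hs hsv

/-- **The same door in the EXACT-`#Ш_an` currency** of the D3X4R1 / F3BW booking doors: datum `#Ш(E)_an = q ∈ ℚ` with
`padicValRat p q = 0` (Cremona / LMFDB value, `p ∤ #Ш_an`). [cite: Kato2004Asterisque, Thm. 17.4 (3) (p. 273)]
[cite: Delbourgo2002, Theorem (B) (p. 40)] [cite: Disegni2017, Theorem A/B] [cite: Miller2011LMS, §1 and Def. 1.1] -/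
theorem classX4Gord_bsdp_rankOne_anyOdd_of_katoHalf_of_branchCoeffOneNeZero_of_shaAnExact
    (hK : Wuthrich2014.kato_halfEigenCharIdeal_dvd_cyclotomicPrime_of_surjective)
    (hCyc : delbourgoDatum_cycLineGrossZagier)
    (hArt : rankinSelbergEulerProductHecke_baseChangeDirichlet_eq) (h73 : GrossZagier1986_thm_I_7_3)
    (hWald : waldspurger_exists_heegnerField_twist_ne_zero)
    (hmod : hasEntireLFunction_rat) (hmodD : nonempty_modularParametrizationData)
    (hmodN : exists_isNewformOf) (hGZK : rank_eq_analyticRank_of_analyticRank_le_one)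
    {W : WeierstrassCurve ℚ} [W.IsElliptic] [W.IsGloballyMinimal] {p : ℕ} [Fact p.Prime]
    (hX : ClassX4Gord W p) (he : semistabilityIndex W p = 2) (hsurj : Surj W p)
    (hr : W.analyticRank = 1) (hne : BranchCoeffOneNeZeroAt W p)
    {q : ℚ} (hq : shaAn W = (q : ℂ)) (hv : padicValRat p q = 0) : BSDp W p :=
  classX4Gord_bsdp_rankOne_anyOdd_of_katoHalf_of_branchCoeffOneNeZero_of_shaAnUnit hK hCyc hArt h73 hWald hmod hmodD
    hmodN hGZK hX he hsurj hr hne hq hv.le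

/-- **ISOGENY-CLASS FORM (the booking unit is the class).** For every globally minimal `E'` that is `ℚ`-isogenous to a
member `E` of the class carrying the door's inputs (X4♯(G-ord) ∩ `I₀*` ∩ surj at the odd prime `p`, `r_an = 1`, `A′ ≠ 0`,
`#Ш(E)_an = s` with `ord_p s ≤ 0`), `BSD(E',p)` holds — Cassels' isogeny invariance of the BSD quotient (`hCassels`, via the
cell's `N10.bsdp_of_isIsogenous_of_bsdp`; the analytic rank is an isogeny invariant unconditionally). On a surj key every
member has `p ∤` the isogeny degrees, so `ord_p #Ш_an` is the same on all members; the statement does not use that.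
[cite: MilneADT2006, Thm. I.7.3 and Remark I.7.4] [cite: Kato2004Asterisque, Thm. 17.4 (3) (p. 273)]
[cite: Delbourgo2002, Theorem (B) (p. 40)] [cite: Disegni2017, Theorem A/B] [cite: Miller2011LMS, §1 and Def. 1.1] -/
theorem isogenous_bsdp_rankOne_anyOdd_of_classX4Gord_of_katoHalf_of_branchCoeffOneNeZero_of_shaAnUnit
    (hCassels : bsdRHS_eq_of_isIsogenous)
    (hK : Wuthrich2014.kato_halfEigenCharIdeal_dvd_cyclotomicPrime_of_surjective)
    (hCyc : delbourgoDatum_cycLineGrossZagier)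
    (hArt : rankinSelbergEulerProductHecke_baseChangeDirichlet_eq) (h73 : GrossZagier1986_thm_I_7_3)
    (hWald : waldspurger_exists_heegnerField_twist_ne_zero)
    (hmod : hasEntireLFunction_rat) (hmodD : nonempty_modularParametrizationData)
    (hmodN : exists_isNewformOf) (hGZK : rank_eq_analyticRank_of_analyticRank_le_one)
    {W W' : WeierstrassCurve ℚ} [W.IsElliptic] [W.IsGloballyMinimal] [W'.IsElliptic] [W'.IsGloballyMinimal]
    {p : ℕ} [Fact p.Prime] (hiso : IsIsogenous W' W)
    (hX : ClassX4Gord W p) (he : semistabilityIndex W p = 2) (hsurj : Surj W p)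
    (hr : W.analyticRank = 1) (hne : BranchCoeffOneNeZeroAt W p)
    {s : ℚ} (hs : shaAn W = (s : ℂ)) (hsv : padicValRat p s ≤ 0) : BSDp W' p := by
  have hr' : W'.analyticRank ≤ 1 := by rw [analyticRank_eq_of_isIsogenous' hiso, hr]
  exact N10.bsdp_of_isIsogenous_of_bsdp p hCassels hGZK hmod hiso hr'
    (classX4Gord_bsdp_rankOne_anyOdd_of_katoHalf_of_branchCoeffOneNeZero_of_shaAnUnit hK hCyc hArt h73 hWald hmod
      hmodD hmodN hGZK hX he hsurj hr hne hs hsv)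

/-! ### §2 (gen 6, append) The same doors with the binder `hArt` DISCHARGED

The Artin-formalism input `rankinSelbergEulerProductHecke_baseChangeDirichlet_eq` (`hArt`) is a tree THEOREM since
p443038 (`…_holds`, `Literature/NumberTheory/EllipticCurves/RankinSelbergBaseChangeDirichlet.lean`, lit g17); the doors
below feed it by name, so a booking row displays one binder fewer: `hK` + cite-only `hCyc h73 hWald hmod hmodD hmodN hGZK`
(+ `hCassels` for the class form) + `A′ ≠ 0` + the datum. -/

/-- **ONE door per key, every odd `p`, EXACT-`#Ш_an` currency, `hArt` discharged**: X4♯(G-ord) ∩ `I₀*` ∩ surj,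
`r_an = 1`: `BSD(E,p)` ⟸ `hK` + `hCyc h73 hWald hmod hmodD hmodN hGZK` + `A′ ≠ 0` + (`#Ш(E)_an = q`, `padicValRat p q = 0`).
[cite: Kato2004Asterisque, Thm. 17.4 (3) (p. 273)] [cite: Delbourgo2002, Theorem (B) (p. 40)]
[cite: Disegni2017, Theorem A/B] [cite: Gross2004, §3 (p. 40) and §13 (p. 49)] [cite: Miller2011LMS, §1 and Def. 1.1] -/
theorem classX4Gord_bsdp_rankOne_anyOdd_of_katoHalf_of_branchCoeffOneNeZero_of_shaAnExact_artFree
    (hK : Wuthrich2014.kato_halfEigenCharIdeal_dvd_cyclotomicPrime_of_surjective)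
    (hCyc : delbourgoDatum_cycLineGrossZagier) (h73 : GrossZagier1986_thm_I_7_3)
    (hWald : waldspurger_exists_heegnerField_twist_ne_zero)
    (hmod : hasEntireLFunction_rat) (hmodD : nonempty_modularParametrizationData)
    (hmodN : exists_isNewformOf) (hGZK : rank_eq_analyticRank_of_analyticRank_le_one)
    {W : WeierstrassCurve ℚ} [W.IsElliptic] [W.IsGloballyMinimal] {p : ℕ} [Fact p.Prime]
    (hX : ClassX4Gord W p) (he : semistabilityIndex W p = 2) (hsurj : Surj W p)
    (hr : W.analyticRank = 1) (hne : BranchCoeffOneNeZeroAt W p)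
    {q : ℚ} (hq : shaAn W = (q : ℂ)) (hv : padicValRat p q = 0) : BSDp W p :=
  classX4Gord_bsdp_rankOne_anyOdd_of_katoHalf_of_branchCoeffOneNeZero_of_shaAnUnit hK hCyc
    rankinSelbergEulerProductHecke_baseChangeDirichlet_eq_holds h73 hWald hmod hmodD hmodN hGZK hX he hsurj hr hne hq
    hv.le

/-- **ISOGENY-CLASS form, EXACT currency, `hArt` discharged**: for every globally minimal `E'` `ℚ`-isogenous to the
door's member `E`, `BSD(E',p)` (Cassels `hCassels`). This is the shape a class booking names: one member `E` with the
decidable data + `A′ ≠ 0` + `p ∤ #Ш(E)_an`, every other member by transport.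
[cite: MilneADT2006, Thm. I.7.3 and Remark I.7.4] [cite: Kato2004Asterisque, Thm. 17.4 (3) (p. 273)]
[cite: Delbourgo2002, Theorem (B) (p. 40)] [cite: Disegni2017, Theorem A/B] [cite: Miller2011LMS, §1 and Def. 1.1] -/
theorem isogenous_bsdp_rankOne_anyOdd_of_classX4Gord_of_katoHalf_of_branchCoeffOneNeZero_of_shaAnExact_artFree
    (hCassels : bsdRHS_eq_of_isIsogenous)
    (hK : Wuthrich2014.kato_halfEigenCharIdeal_dvd_cyclotomicPrime_of_surjective)
    (hCyc : delbourgoDatum_cycLineGrossZagier) (h73 : GrossZagier1986_thm_I_7_3)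
    (hWald : waldspurger_exists_heegnerField_twist_ne_zero)
    (hmod : hasEntireLFunction_rat) (hmodD : nonempty_modularParametrizationData)
    (hmodN : exists_isNewformOf) (hGZK : rank_eq_analyticRank_of_analyticRank_le_one)
    {W W' : WeierstrassCurve ℚ} [W.IsElliptic] [W.IsGloballyMinimal] [W'.IsElliptic] [W'.IsGloballyMinimal]
    {p : ℕ} [Fact p.Prime] (hiso : IsIsogenous W' W)
    (hX : ClassX4Gord W p) (he : semistabilityIndex W p = 2) (hsurj : Surj W p)
    (hr : W.analyticRank = 1) (hne : BranchCoeffOneNeZeroAt W p)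
    {q : ℚ} (hq : shaAn W = (q : ℂ)) (hv : padicValRat p q = 0) : BSDp W' p :=
  isogenous_bsdp_rankOne_anyOdd_of_classX4Gord_of_katoHalf_of_branchCoeffOneNeZero_of_shaAnUnit hCassels hK hCyc
    rankinSelbergEulerProductHecke_baseChangeDirichlet_eq_holds h73 hWald hmod hmodD hmodN hGZK hiso hX he hsurj hr hne hq
    hv.le

end Summit.BirchSwinnertonDyer.BirchSwinnertonDyer.Theorems.AdditiveBranchIMCGordTwoRankOne

end
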